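import Literature.RingTheory.HilbertSamuel.NuInvariantLocal
import Literature.AlgebraicGeometry.Resolution.DirectrixScheme
import HarnessLib

/-!
# `ν*_x(X)`: the absolute `ν`-invariant at the points of a locally noetherian scheme
# (Cossart–Jannsen–Saito 2020, Def. 2.26)

Topic: `Literature/AlgebraicGeometry/Resolution`. CJS, LNM 2270, Def. 2.26: "For any point `x ∈ X`
define `ν*_x(X) = ν*(𝒪_{X,x})`" (the absolute `ν*`-invariant of Def. 2.17 (3), `nuInvAbs` of
`NuInvariantLocal.lean`). DEFINITION and the invariances PROVED at the level of local rings: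

* `Scheme.nuInvAbs X x i = ν^{i+1}_x(X)`;
* `Scheme.nuInvAbs_eq` — computed in any minimal system of generators of `𝔪_x`;
* `Scheme.nuInvAbs_mono` — `ν^1_x ≤ ν^2_x ≤ ⋯`.

(The relative invariant `ν*_x(X, Z) = ν*(J_x, 𝒪_{Z,x})` for a closed subscheme `X ⊆ Z` of a regular
scheme is `nuInvRel` applied to a regular system of parameters of `𝒪_{Z,x}` and the stalk ideal
`J_x`; it is not packaged here.)

## References

* V. Cossart, U. Jannsen, S. Saito, *Desingularization: Invariants and Strategy*, LNM 2270
  (2020), Ch. 2, Def. 2.26 (with Def. 2.17). [CossartJannsenSaito2020]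
-/

noncomputable section

open CategoryTheory AlgebraicGeometry TopologicalSpace IsLocalRing
open Literature.RingTheory.HilbertSamuel Literature.RingTheory.MvPolynomial

namespace Literature.AlgebraicGeometry.Resolution

universe u

variable (X : Scheme.{u}) [IsLocallyNoetherian X]

/-- **`ν^{i+1}_x(X) = ν^{i+1}(𝒪_{X,x})`**, the absolute `ν`-invariant of `X` at `x` (CJS Def. 2.26 /
Def. 2.17 (3)). [cite: CossartJannsenSaito2020, Def. 2.26] -/
def Scheme.nuInvAbs (x : X) (i : ℕ) : ℕ∞ :=
  Literature.RingTheory.HilbertSamuel.nuInvAbs (X.presheaf.stalk x) i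

variable {X}

/-- `ν*_x(X)` may be computed in any minimal system of generators of `𝔪_x`.
[cite: CossartJannsenSaito2020, Def. 2.26] -/
theorem Scheme.nuInvAbs_eq (x : X)
    (c : Fin (maximalIdeal (X.presheaf.stalk x)).spanFinrank → X.presheaf.stalk x)
    (hc : Ideal.span (Set.range c) = maximalIdeal (X.presheaf.stalk x)) (i : ℕ) :
    Scheme.nuInvAbs X x i = nuInv (tangentConeIdeal c hc) i :=
  Literature.RingTheory.HilbertSamuel.nuInvAbs_eq c hc i

/-- **`ν^1_x(X) ≤ ν^2_x(X) ≤ ⋯`.** [cite: CossartJannsenSaito2020, Def. 2.1] -/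
theorem Scheme.nuInvAbs_mono (x : X) : Monotone (Scheme.nuInvAbs X x) :=
  nuInv_mono _

end Literature.AlgebraicGeometry.Resolution

end
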